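import Summits.QuantumFields.YangMills.Theorems.BalabanUVNodesN15VectorPieceVWords
import Summits.QuantumFields.YangMills.Theorems.BalabanUVNodesN15ContourSums
import HarnessLib

/-!
# Route «BalabanUVNodes» (K4 «SpineRates»), node N15 = NE2 — THE LINEARISED AVERAGING-PERTURBATION SPECIES AND ITS SIX LETTERS: `F₂(A′) = Q∘M_{k(A′)}`,
# `F₂*(A′) = M_{k(A′)}∘Q*` with the FIRST-ORDER contour kernel `k(A′)(x) = ad(η·Σ_{b ∈ Γ_{B(x),x}} A′(b))` in coordinates — sup letters from `‖A′‖`, fit letters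
# from the contour projection (`…N15ContourSums`) and the fibre oscillation of `A′`; hence `NE2PlusOperator` BY NAME for the U = 1 vector piece ⊗ 1_𝔤 dressed by
# `V′₁(A′) − [F₂*aQ + Q*aF₂ + F₂*aF₂](A′)` with THIS species — no species letter left displayed

Cell `pub-ymgap`, seat `pub-ymgap-dag-n15-c` (generation g4; R134 ACCELERATION SEAT, strategy s1 «first missing estimate»; HUMAN RULING D-0062; chair R424 venue;
`bears_on: R4∕N15`).  Filed `--supports stmt-QuantumFields-19908 --as helper` (K3′; helper).  Imports BY NAME, nothing in the tree modified: this seat's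
`…N15VectorPieceVWords` (**`ne2PlusOperator_vectorPiece_vWordsG`**, `qbond`, `card_fibre_kingPrV_lift`, `vWGVecFamily4`; through it (V5) `fibAvg`, `hasMaj_fibAvg_comp`,
`hasMaj_idef_fibAvg_comp`, (V4) `fibre_conn_kingPrV`, `bshiftEquiv`, `reg335_v1GVec_iff`, G1 `gavgM`, n15-b 13c `fit_blockAvgV`∕`norm_blockAvgV_le`, 14 `mmulOp`∕
`hasMaj_mmulOp`, 16 `coordMat`∕`basisConst`∕`rowBound_of_opNormBound`∕`hasMaj_idef_mmulOp_of_opNormFit`, 13a `norm_adCLM_le_of_le`∕`norm_adCLM_sub_le`, `adCLM`) and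
`…N15ContourSums` (`lineSum`, `norm_lineSum_le`, **`norm_lineSum_two_spacing_le`**).

THE POINT.  `…N15VectorPieceVWords` proved `NE2PlusOperator` for the full-perturbation family for ANY averaging-perturbation species carrying six letters (sup for
`F₂, F₂*, F₂′, F₂*′`; two-spacing fits for `(F₂′, F₂)`, `(F₂*′, F₂*)`), all DISPLAYED.  THIS FILE inhabits them with the species the print's `F′₂ⱼ(A)` of
[Balaban1985BackgroundPropagators] (3.57)–(3.58) has TO FIRST ORDER in `A′` at `U ≡ 1`: kernel `F′₂(A; y, x) ↦ k(A′)(x) = ad(η·Σ_{b ∈ Γ_{B(x),x}} A′(b))` (the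
staircase contour from the block corner, `…N15ContourSums`), read in coordinates `e : 𝔄 ≃L[ℝ] ℝ^ι`; `F₂(A′) = Q∘M_{k(A′)}` (mean over the block of the kernel
times `λ`), `F₂*(A′) = M_{k(A′)}∘Q*`; coarse side at `η = L^{−k}` with the fibrewise-mean field `Ā`, fine side at `η′ = L^{−k}L^{−m}` with `A′`.  THE LETTERS
(`linF_letters`): sup — a contour has `≤ (d+1)·n` bonds of weight `η = 1∕n`, so `‖k‖ ≤ 2(d+1)·c₃₅Mα₀` (`‖ad Z‖ ≤ 2‖Z‖`), rows `≤ κ_e·2(d+1)·c₃₅Mα₀`; fit — by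
`norm_lineSum_two_spacing_le` with the pointwise fit `‖A′ − Ā∘pr‖ ≤ C_π·c₃₅Mα₀·η′` (fibre oscillation through (V4)'s step-connectivity, `C_π = 2(d+1)(L^m − 1)`,
`C_πη′ ≤ 2(d+1)θ_j`) and the remainder `η·c₃₅Mα₀ ≤ θ_j·c₃₅Mα₀`: `‖k′(x′) − k(pr x′)‖ ≤ 2(d+1)(2d+3)·c₃₅Mα₀·θ_j`; (V5) §5 moves both through `Q` (uniform fibres).
So `c_F = 2(d+1)(2d+3)·κ_e` and **`ne2PlusOperator_vectorPiece_vWordsLin`**: `NE2PlusOperator c₃₅` for `v1GVecInstance` with `vWGVecFamily4 … (linFc) (linFsc) (linFf)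
(linFsf)` — every species letter a theorem.

CONTENTS.  §1 `linCF` (`linCF_nonneg_le`), `linKerC`∕`linKerF` (the kernels), `linFc`∕`linFsc`∕`linFf`∕`linFsf` (the species); **`linF_letters`** (inside: the kernel
sizes `‖k‖, ‖k′‖ ≤ 2(d+1)·c₃₅Mα₀` and the kernel fit `‖k′ − k∘pr‖ ≤ 2(d+1)(2d+3)·c₃₅Mα₀·θ_j`).  §2 **`ne2PlusOperator_vectorPiece_vWordsLin`**, `_dim4`,
`ne2ZeroOperator_vectorPiece_vWordsLin`.

HONEST FRAMING ∕ LIMITS.  The species is the FIRST-ORDER (in `A′`) kernel of (3.57) at `U ≡ 1`, on the one-level staircase contour from the block corner — NOT the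
print's full `F′₂ⱼ(A)` (products of parallel transports, multi-level contours, the rotations `R(·)`), whose one-spacing bound (3.58) is the Literature cell's
`B9Eq358KeyEstimate` on a different carrier; the starred kernel is taken equal to the unstarred one (first order, orientation immaterial for the letters); `Q` =
plain unit-block mean componentwise; (3.35) = OUR unit-scale C² letters; transport = fibrewise mean (linearised (C3)); LINEAR (U = 1) vector piece; NOT NODE 00's
carriers.  NE2⁺ NOT PRINTED; count-neutral (typed 28∕28 · discharged unchanged); NOT a discharge of N15; one finite T⁴ at fixed ε — NOT infinite volume, NOT OS
on ℝ⁴, NOT a mass gap, NOT Clay.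
-/

noncomputable section

open scoped BigOperators
open Finset

namespace Summit.QuantumFields.YangMills.BalabanUVNodes.N15.VectorPiece

open Literature.MathematicalPhysics.QuantumFieldTheory.Balaban1983to89
open Literature.MathematicalPhysics.QuantumFieldTheory.Balaban1983to89.B11SectG (BlockNorm HasMaj)
open Literature.MathematicalPhysics.QuantumFieldTheory.Balaban1983to89.T4EtaRate (PairedInstance NE2PlusOperator NE2ZeroOperator ne2Zero_of_ne2Plus)
open Literature.MathematicalPhysics.QuantumFieldTheory.Balaban1983to89.T4EtaRateDefect (idef)
open Literature.MathematicalPhysics.QuantumFieldTheory.Balaban1983to89.T4EtaRateCoeffDefect (pull diagK diagK_mono)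
open Literature.MathematicalPhysics.QuantumFieldTheory.Balaban1983to89.B5Prop11Plancherel (Tor fine unitVec)
open Literature.MathematicalPhysics.QuantumFieldTheory.Balaban1983to89.Beta.AveragingCorrectionJets (adCLM)
open Summit.QuantumFields.YangMills.BalabanUVNodes.N15.MatrixSpecies (liftMap liftBlk coordMat basisConst basisConst_nonneg mmulOp hasMaj_mmulOp
  rowBound_of_opNormBound hasMaj_idef_mmulOp_of_opNormFit norm_adCLM_le_of_le norm_adCLM_sub_le blockAvgV fit_blockAvgV norm_blockAvgV_le)
open Summit.QuantumFields.YangMills.BalabanUVNodes.N15.BackgroundLayer (gavgM fibAvg hasMaj_fibAvg_comp hasMaj_idef_fibAvg_comp)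

variable {d : ℕ}

/-! ## §1 The linearised species and its six letters -/

section Species

variable {𝔄 : Type} [NormedRing 𝔄] [NormedAlgebra ℝ 𝔄] [CompleteSpace 𝔄] (ι : Type) [Fintype ι] [DecidableEq ι] (e : 𝔄 ≃L[ℝ] (ι → ℝ)) (L : ℕ) [NeZero L]

/-- THE SPECIES CONSTANT `c_F = 2(d+1)(2d+3)·κ`. [folklore] -/
def linCF (d : ℕ) (κ : ℝ) : ℝ := 2 * ((d : ℝ) + 1) * (2 * ((d : ℝ) + 1) + 1) * κ

omit [NeZero L] in
/-- `0 ≤ c_F` and `2(d+1)κ ≤ c_F` for `κ ≥ 0`. [folklore] -/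
theorem linCF_nonneg_le {κ : ℝ} (hκ : 0 ≤ κ) : 0 ≤ linCF d κ ∧ 2 * ((d : ℝ) + 1) * κ ≤ linCF d κ := by
  have hd : (0 : ℝ) ≤ (d : ℝ) + 1 := by positivity
  unfold linCF
  refine ⟨by positivity, ?_⟩
  nlinarith [mul_nonneg hd hκ]

/-- THE COARSE FIRST-ORDER KERNEL at index `j` for the gauge field `A′`: `k(x) = ad(η·Σ_{b ∈ Γ_{B(x),x}} Ā(b))`, `η = L^{−k}`, `Ā` = the fibrewise mean of `A′`.
[cite: Balaban1985BackgroundPropagators, (3.57)–(3.58) pp.401–402 (the kernel `F′₂(A; y, x)`: first-order shape)] -/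
def linKerC (j : VecIndexS d L) (A' : Fin (d + 1) → Tor (fine (L ^ j.m * L ^ j.k) j.Mn) × Fin (d + 1) → 𝔄)
    (p : Tor (fine (L ^ j.k) j.Mn) × Fin (d + 1)) : 𝔄 →L[ℝ] 𝔄 :=
  adCLM ℝ ((((L : ℝ) ^ j.k)⁻¹) • lineSum (L ^ j.k) j.Mn (gavgM 𝔄 (Fin (d + 1)) (kingPrV L j.k j.m j.Mn) A') p)

/-- THE FINE FIRST-ORDER KERNEL: `k′(x′) = ad(η′·Σ_{b′ ∈ Γ′_{B(x′),x′}} A′(b′))`, `η′ = L^{−k}L^{−m}`. [cite: Balaban1985BackgroundPropagators, (3.57)–(3.58) pp.401–402 (shape)] -/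
def linKerF (j : VecIndexS d L) (A' : Fin (d + 1) → Tor (fine (L ^ j.m * L ^ j.k) j.Mn) × Fin (d + 1) → 𝔄)
    (p' : Tor (fine (L ^ j.m * L ^ j.k) j.Mn) × Fin (d + 1)) : 𝔄 →L[ℝ] 𝔄 :=
  adCLM ℝ ((((L : ℝ) ^ j.k)⁻¹ * (((L : ℝ) ^ j.m)⁻¹)) • lineSum (L ^ j.m * L ^ j.k) j.Mn A' p')

/-- THE COARSE SPECIES `F₂(A′) = Q∘M_{k(A′)}` (coordinates `e`). [cite: Balaban1985BackgroundPropagators, (3.58)–(3.59) p.402 (shape)] -/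
def linFc (j : VecIndexS d L) (A' : Fin (d + 1) → Tor (fine (L ^ j.m * L ^ j.k) j.Mn) × Fin (d + 1) → 𝔄) :
    ((Tor (fine (L ^ j.k) j.Mn) × Fin (d + 1)) × ι → ℝ) →ₗ[ℝ] ((Tor j.Mn × Fin (d + 1)) × ι → ℝ) :=
  fibAvg (liftMap (qbond L j.k j.Mn) ι) ∘ₗ mmulOp fun p => coordMat e (linKerC L j A' p)

/-- THE COARSE STARRED SPECIES `F₂*(A′) = M_{k(A′)}∘Q*`. [cite: Balaban1985BackgroundPropagators, (3.60) p.402 («F′₂*ⱼ(A) is not an adjoint of F′₂ⱼ(A)»: shape)] -/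
def linFsc (j : VecIndexS d L) (A' : Fin (d + 1) → Tor (fine (L ^ j.m * L ^ j.k) j.Mn) × Fin (d + 1) → 𝔄) :
    ((Tor j.Mn × Fin (d + 1)) × ι → ℝ) →ₗ[ℝ] ((Tor (fine (L ^ j.k) j.Mn) × Fin (d + 1)) × ι → ℝ) :=
  (mmulOp fun p => coordMat e (linKerC L j A' p)) ∘ₗ pull (liftMap (qbond L j.k j.Mn) ι)

/-- THE FINE SPECIES `F₂′(A′) = Q′∘M_{k′(A′)}`. [cite: Balaban1985BackgroundPropagators, (3.58)–(3.59) p.402 (shape)] -/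
def linFf (j : VecIndexS d L) (A' : Fin (d + 1) → Tor (fine (L ^ j.m * L ^ j.k) j.Mn) × Fin (d + 1) → 𝔄) :
    ((Tor (fine (L ^ j.m * L ^ j.k) j.Mn) × Fin (d + 1)) × ι → ℝ) →ₗ[ℝ] ((Tor j.Mn × Fin (d + 1)) × ι → ℝ) :=
  fibAvg (liftMap (qbond L j.k j.Mn) ι ∘ liftMap (kingPrV L j.k j.m j.Mn) ι) ∘ₗ mmulOp fun p' => coordMat e (linKerF L j A' p')

/-- THE FINE STARRED SPECIES `F₂*′(A′) = M_{k′(A′)}∘Q′*`. [cite: Balaban1985BackgroundPropagators, (3.60) p.402 (shape)] -/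
def linFsf (j : VecIndexS d L) (A' : Fin (d + 1) → Tor (fine (L ^ j.m * L ^ j.k) j.Mn) × Fin (d + 1) → 𝔄) :
    ((Tor j.Mn × Fin (d + 1)) × ι → ℝ) →ₗ[ℝ] ((Tor (fine (L ^ j.m * L ^ j.k) j.Mn) × Fin (d + 1)) × ι → ℝ) :=
  (mmulOp fun p' => coordMat e (linKerF L j A' p')) ∘ₗ pull (liftMap (qbond L j.k j.Mn) ι ∘ liftMap (kingPrV L j.k j.m j.Mn) ι)

variable {ι L}

omit [CompleteSpace 𝔄] in
/-- **THE SIX LETTERS OF THE LINEARISED SPECIES.**  `L ≥ 1`; at index `j`, `c₃₅ > 0`, `α₀ > 0`, a gauge field `A′` regular in the sense of the realised gauge carrier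
(`‖A′‖ ≤ c₃₅Mα₀`, one-step differences `≤ c₃₅Mα₀·η′`): with `c_F = 2(d+1)(2d+3)κ_e` the sup letters `≤ diagK (c_F·c₃₅Mα₀)` of `F₂, F₂*, F₂′, F₂*′` and the fit
letters `𝔇(F₂′, F₂), 𝔇(F₂*′, F₂*) ≤ diagK (c_F·c₃₅Mα₀·θ_j)`. [cite: Balaban1985BackgroundPropagators, (3.58)–(3.59) p.402 (the sup letter: shape); (3.35) p.396; King1986, p.664] -/
theorem linF_letters (hL : 1 ≤ L) (j : VecIndexS d L) {c35 α₀ : ℝ} (hc35 : 0 < c35) (hα₀ : 0 < α₀)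
    {A' : Fin (d + 1) → Tor (fine (L ^ j.m * L ^ j.k) j.Mn) × Fin (d + 1) → 𝔄} (hreg : (v1GVecInstance (d := d) 𝔄 ι L hL j).Bf.Reg335 c35 α₀ A') :
    HasMaj (BlockNorm.ofBlocks (unitTorusGeoS L j.k j.Mn j.Msz) (liftBlk (blkFine L j.k j.Mn) ι))
        (BlockNorm.ofBlocks (unitTorusGeoS L j.k j.Mn j.Msz) (liftBlk (fun b : Tor j.Mn × Fin (d + 1) => b.1) ι)) (linFc ι e L j A')
        (diagK fun _ => linCF d (basisConst e) * (c35 * j.Msz * α₀)) ∧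
      HasMaj (BlockNorm.ofBlocks (unitTorusGeoS L j.k j.Mn j.Msz) (liftBlk (fun b : Tor j.Mn × Fin (d + 1) => b.1) ι))
        (BlockNorm.ofBlocks (unitTorusGeoS L j.k j.Mn j.Msz) (liftBlk (blkFine L j.k j.Mn) ι)) (linFsc ι e L j A')
        (diagK fun _ => linCF d (basisConst e) * (c35 * j.Msz * α₀)) ∧
      HasMaj (BlockNorm.ofBlocks (unitTorusGeoS L j.k j.Mn j.Msz) (liftBlk (blkFine L j.k j.Mn ∘ kingPrV L j.k j.m j.Mn) ι))
        (BlockNorm.ofBlocks (unitTorusGeoS L j.k j.Mn j.Msz) (liftBlk (fun b : Tor j.Mn × Fin (d + 1) => b.1) ι)) (linFf ι e L j A')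
        (diagK fun _ => linCF d (basisConst e) * (c35 * j.Msz * α₀)) ∧
      HasMaj (BlockNorm.ofBlocks (unitTorusGeoS L j.k j.Mn j.Msz) (liftBlk (fun b : Tor j.Mn × Fin (d + 1) => b.1) ι))
        (BlockNorm.ofBlocks (unitTorusGeoS L j.k j.Mn j.Msz) (liftBlk (blkFine L j.k j.Mn ∘ kingPrV L j.k j.m j.Mn) ι)) (linFsf ι e L j A')
        (diagK fun _ => linCF d (basisConst e) * (c35 * j.Msz * α₀)) ∧
      HasMaj (BlockNorm.ofBlocks (unitTorusGeoS L j.k j.Mn j.Msz) (liftBlk (blkFine L j.k j.Mn) ι))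
        (BlockNorm.ofBlocks (unitTorusGeoS L j.k j.Mn j.Msz) (liftBlk (fun b : Tor j.Mn × Fin (d + 1) => b.1) ι))
        (idef (pull (liftMap (kingPrV L j.k j.m j.Mn) ι)) LinearMap.id (linFf ι e L j A') (linFc ι e L j A'))
        (diagK fun _ => linCF d (basisConst e) * (c35 * j.Msz * α₀) * thetaV L j) ∧
      HasMaj (BlockNorm.ofBlocks (unitTorusGeoS L j.k j.Mn j.Msz) (liftBlk (fun b : Tor j.Mn × Fin (d + 1) => b.1) ι))
        (BlockNorm.ofBlocks (unitTorusGeoS L j.k j.Mn j.Msz) (liftBlk (blkFine L j.k j.Mn ∘ kingPrV L j.k j.m j.Mn) ι))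
        (idef LinearMap.id (pull (liftMap (kingPrV L j.k j.m j.Mn) ι)) (linFsf ι e L j A') (linFsc ι e L j A'))
        (diagK fun _ => linCF d (basisConst e) * (c35 * j.Msz * α₀) * thetaV L j) := by
  obtain ⟨h1, h2, -⟩ := (reg335_v1GVec_iff (d := d) 𝔄 ι L hL j c35 α₀ A').1 hreg
  -- constants
  set r : ℝ := c35 * j.Msz * α₀ with hr_def
  have hM0 : 0 ≤ j.Msz := zero_le_one.trans j.one_le_Msz
  have hr0 : 0 ≤ r := by positivity
  have hL0 : L ≠ 0 := by omega
  have hLr : (0 : ℝ) < (L : ℝ) := by exact_mod_cast (show 0 < L by omega)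
  have hLk : (0 : ℝ) < (L : ℝ) ^ j.k := pow_pos hLr _
  have hLm : (0 : ℝ) < (L : ℝ) ^ j.m := pow_pos hLr _
  set ηc : ℝ := ((L : ℝ) ^ j.k)⁻¹ with hηc
  set ηf : ℝ := ((L : ℝ) ^ j.k)⁻¹ * ((L : ℝ) ^ j.m)⁻¹ with hηf
  have hηc0 : 0 ≤ ηc := inv_nonneg.2 hLk.le
  have hηf0 : 0 ≤ ηf := mul_nonneg hηc0 (inv_nonneg.2 hLm.le)
  have hηcf : ηc = ((L ^ j.m : ℕ) : ℝ) * ηf := by rw [hηf, hηc]; push_cast; field_simp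
  have hθ0 : 0 ≤ thetaV L j := by unfold thetaV; positivity
  have hηθ : ηc ≤ thetaV L j := inv_pow_le_rpow hL j.k (by norm_num)
  have hd1 : (0 : ℝ) ≤ 2 * ((d : ℝ) + 1) := by positivity
  have hκ : 0 ≤ basisConst e := basisConst_nonneg e
  obtain ⟨hcF0, hcF1⟩ := linCF_nonneg_le (d := d) hκ
  -- `C_π η′ ≤ 2(d+1) θ_j`
  set Cπ : ℝ := ((2 * ((d + 1) * (L ^ j.m - 1)) : ℕ) : ℝ) with hCπ
  have hCπ0 : 0 ≤ Cπ := Nat.cast_nonneg _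
  have hCθ : Cπ * ηf ≤ 2 * ((d : ℝ) + 1) * thetaV L j := by
    have hsub : (((L ^ j.m - 1 : ℕ)) : ℝ) ≤ (L : ℝ) ^ j.m := by
      have h1' : 1 ≤ L ^ j.m := Nat.one_le_pow _ _ (by omega)
      rw [Nat.cast_sub h1']; push_cast; linarith
    have hcast : Cπ = 2 * ((d : ℝ) + 1) * (((L ^ j.m - 1 : ℕ)) : ℝ) := by rw [hCπ]; push_cast; ring
    rw [hcast, hηf]
    calc 2 * ((d : ℝ) + 1) * (((L ^ j.m - 1 : ℕ)) : ℝ) * (((L : ℝ) ^ j.k)⁻¹ * ((L : ℝ) ^ j.m)⁻¹)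
        ≤ 2 * ((d : ℝ) + 1) * (L : ℝ) ^ j.m * (((L : ℝ) ^ j.k)⁻¹ * ((L : ℝ) ^ j.m)⁻¹) :=
          mul_le_mul_of_nonneg_right (mul_le_mul_of_nonneg_left hsub hd1) (by positivity)
      _ = 2 * ((d : ℝ) + 1) * ((L : ℝ) ^ j.k)⁻¹ := by field_simp
      _ ≤ 2 * ((d : ℝ) + 1) * thetaV L j := mul_le_mul_of_nonneg_left hηθ hd1
  -- the fields: sizes and the pointwise fit of `A′` to its fibrewise mean
  set Abar := gavgM 𝔄 (Fin (d + 1)) (kingPrV L j.k j.m j.Mn) A' with hAbar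
  have hA' : ∀ μ b, ‖A' μ b‖ ≤ r := h1
  have hAbar_le : ∀ μ b, ‖Abar μ b‖ ≤ r := fun μ b => norm_blockAvgV_le (kingPrV L j.k j.m j.Mn) hr0 (h1 μ) b
  have hosc : ∀ μ x₁ x₂, kingPrV L j.k j.m j.Mn x₁ = kingPrV L j.k j.m j.Mn x₂ → ‖A' μ x₁ - A' μ x₂‖ ≤ Cπ * (r * ηf) := fun μ =>
    fibre_conn_kingPrV L j.k j.m j.Mn (A' μ) (r * ηf) fun κ i => by
      have := h2 μ κ i
      simpa [bshiftEquiv_apply, hr_def, hηf] using this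
  have hfitA : ∀ μ b', ‖A' μ b' - Abar μ (kingPrV L j.k j.m j.Mn b')‖ ≤ Cπ * (r * ηf) := fun μ b' =>
    fit_blockAvgV (kingPrV L j.k j.m j.Mn) (Ω := fun _ => Cπ * (r * ηf)) (fun x₁ x₂ h => hosc μ x₁ x₂ h) b'
  -- the kernels: sizes
  have hnk : ((L ^ j.k : ℕ) : ℝ) * ηc = 1 := by rw [hηc]; push_cast; field_simp
  have hnf : ((L ^ j.m * L ^ j.k : ℕ) : ℝ) * ηf = 1 := by rw [hηf]; push_cast; field_simp
  have hkerC : ∀ p, ‖linKerC L j A' p‖ ≤ 2 * ((d : ℝ) + 1) * r := fun p => by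
    have hs : ‖ηc • lineSum (L ^ j.k) j.Mn Abar p‖ ≤ ((d : ℝ) + 1) * r := by
      rw [norm_smul, Real.norm_eq_abs, abs_of_nonneg hηc0]
      calc ηc * ‖lineSum (L ^ j.k) j.Mn Abar p‖ ≤ ηc * (((d : ℝ) + 1) * (L ^ j.k : ℕ) * r) :=
            mul_le_mul_of_nonneg_left (norm_lineSum_le (L ^ j.k) j.Mn hr0 hAbar_le p) hηc0
        _ = ((d : ℝ) + 1) * r * (((L ^ j.k : ℕ) : ℝ) * ηc) := by ring
        _ = ((d : ℝ) + 1) * r := by rw [hnk, mul_one]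
    have := norm_adCLM_le_of_le (𝔄 := 𝔄) hs
    simpa [linKerC, hAbar, hηc, mul_assoc, mul_left_comm, mul_comm] using this
  have hkerF : ∀ p', ‖linKerF L j A' p'‖ ≤ 2 * ((d : ℝ) + 1) * r := fun p' => by
    have hs : ‖ηf • lineSum (L ^ j.m * L ^ j.k) j.Mn A' p'‖ ≤ ((d : ℝ) + 1) * r := by
      rw [norm_smul, Real.norm_eq_abs, abs_of_nonneg hηf0]
      calc ηf * ‖lineSum (L ^ j.m * L ^ j.k) j.Mn A' p'‖ ≤ ηf * (((d : ℝ) + 1) * (L ^ j.m * L ^ j.k : ℕ) * r) :=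
            mul_le_mul_of_nonneg_left (norm_lineSum_le (L ^ j.m * L ^ j.k) j.Mn hr0 hA' p') hηf0
        _ = ((d : ℝ) + 1) * r * (((L ^ j.m * L ^ j.k : ℕ) : ℝ) * ηf) := by ring
        _ = ((d : ℝ) + 1) * r := by rw [hnf, mul_one]
    have := norm_adCLM_le_of_le (𝔄 := 𝔄) hs
    simpa [linKerF, hηf, mul_assoc, mul_left_comm, mul_comm] using this
  -- the kernels: the two-spacing fit
  have hkerD : ∀ p', ‖linKerF L j A' p' - linKerC L j A' (kingPrV L j.k j.m j.Mn p')‖ ≤ linCF d 1 * r * thetaV L j := fun p' => by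
    have hls := norm_lineSum_two_spacing_le L j.k j.m j.Mn (E := 𝔄) hr0 (mul_nonneg hCπ0 (mul_nonneg hr0 hηf0)) hηf0 hηcf hA' hfitA p'
    have hbound : ((d : ℝ) + 1) * (((L ^ j.k : ℕ) : ℝ) * ((L ^ j.m : ℕ) : ℝ) * ηf * (Cπ * (r * ηf)) + ((L ^ j.m : ℕ) : ℝ) * ηf * r) ≤
        ((d : ℝ) + 1) * (2 * ((d : ℝ) + 1) + 1) * r * thetaV L j := by
      have e1 : ((L ^ j.k : ℕ) : ℝ) * ((L ^ j.m : ℕ) : ℝ) * ηf = 1 := by rw [← hnf]; push_cast; ring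
      have e2 : ((L ^ j.m : ℕ) : ℝ) * ηf = ηc := by rw [hηcf]
      rw [e1, one_mul, e2]
      have h3 : Cπ * (r * ηf) ≤ 2 * ((d : ℝ) + 1) * thetaV L j * r := by nlinarith [mul_le_mul_of_nonneg_right hCθ hr0]
      have h4 : ηc * r ≤ thetaV L j * r := mul_le_mul_of_nonneg_right hηθ hr0
      have hd0 : (0 : ℝ) ≤ (d : ℝ) + 1 := by positivity
      nlinarith [mul_le_mul_of_nonneg_left (add_le_add h3 h4) hd0]
    calc ‖linKerF L j A' p' - linKerC L j A' (kingPrV L j.k j.m j.Mn p')‖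
        ≤ 2 * ‖ηf • lineSum (L ^ j.m * L ^ j.k) j.Mn A' p' - ηc • lineSum (L ^ j.k) j.Mn Abar (kingPrV L j.k j.m j.Mn p')‖ :=
          norm_adCLM_sub_le _ _
      _ ≤ 2 * (((d : ℝ) + 1) * (((L ^ j.k : ℕ) : ℝ) * ((L ^ j.m : ℕ) : ℝ) * ηf * (Cπ * (r * ηf)) + ((L ^ j.m : ℕ) : ℝ) * ηf * r)) :=
          mul_le_mul_of_nonneg_left hls zero_le_two
      _ ≤ 2 * (((d : ℝ) + 1) * (2 * ((d : ℝ) + 1) + 1) * r * thetaV L j) := mul_le_mul_of_nonneg_left hbound zero_le_two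
      _ = linCF d 1 * r * thetaV L j := by unfold linCF; ring
  -- the multipliers' letters in coordinates
  have hrow : ∀ (p : Tor (fine (L ^ j.k) j.Mn) × Fin (d + 1)) i, ∑ j', |coordMat e (linKerC L j A' p) i j'| ≤ linCF d (basisConst e) * r := fun p i =>
    (rowBound_of_opNormBound e hkerC p i).trans (by
      have : basisConst e * (2 * ((d : ℝ) + 1) * r) = (2 * ((d : ℝ) + 1) * basisConst e) * r := by ring
      rw [this]; exact mul_le_mul_of_nonneg_right hcF1 hr0)
  have hrow' : ∀ (p' : Tor (fine (L ^ j.m * L ^ j.k) j.Mn) × Fin (d + 1)) i, ∑ j', |coordMat e (linKerF L j A' p') i j'| ≤ linCF d (basisConst e) * r :=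
    fun p' i => (rowBound_of_opNormBound e hkerF p' i).trans (by
      have : basisConst e * (2 * ((d : ℝ) + 1) * r) = (2 * ((d : ℝ) + 1) * basisConst e) * r := by ring
      rw [this]; exact mul_le_mul_of_nonneg_right hcF1 hr0)
  have hMc := hasMaj_mmulOp (g := unitTorusGeoS L j.k j.Mn j.Msz) (ι := ι) (blkFine L j.k j.Mn) (m := fun _ => linCF d (basisConst e) * r)
    (fun _ => mul_nonneg hcF0 hr0) (fun p i => hrow p i)
  have hMf := hasMaj_mmulOp (g := unitTorusGeoS L j.k j.Mn j.Msz) (ι := ι) (blkFine L j.k j.Mn ∘ kingPrV L j.k j.m j.Mn)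
    (m := fun _ => linCF d (basisConst e) * r) (fun _ => mul_nonneg hcF0 hr0) (fun p' i => hrow' p' i)
  have hMD := hasMaj_idef_mmulOp_of_opNormFit (g := unitTorusGeoS L j.k j.Mn j.Msz) (ι := ι) e (blkFine L j.k j.Mn) (kingPrV L j.k j.m j.Mn)
    (C' := linKerF L j A') (C := linKerC L j A') (o := fun _ => linCF d 1 * r * thetaV L j)
    (fun _ => mul_nonneg (mul_nonneg (linCF_nonneg_le (d := d) zero_le_one).1 hr0) hθ0) (fun p' => hkerD p')
  have hMD' : HasMaj (BlockNorm.ofBlocks (unitTorusGeoS L j.k j.Mn j.Msz) (liftBlk (blkFine L j.k j.Mn) ι))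
      (BlockNorm.ofBlocks (unitTorusGeoS L j.k j.Mn j.Msz) (liftBlk (blkFine L j.k j.Mn) ι ∘ liftMap (kingPrV L j.k j.m j.Mn) ι))
      (idef (pull (liftMap (kingPrV L j.k j.m j.Mn) ι)) (pull (liftMap (kingPrV L j.k j.m j.Mn) ι)) (mmulOp fun p' => coordMat e (linKerF L j A' p'))
        (mmulOp fun p => coordMat e (linKerC L j A' p))) (diagK fun _ => linCF d (basisConst e) * r * thetaV L j) :=
    hMD.mono fun y y' => diagK_mono (fun _ => le_of_eq (by unfold linCF; ring)) y y'
  -- through `Q` (uniform fibres)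
  have hq : ∀ p : (Tor (fine (L ^ j.k) j.Mn) × Fin (d + 1)) × ι,
      liftBlk (blkFine L j.k j.Mn) ι p = liftBlk (fun b : Tor j.Mn × Fin (d + 1) => b.1) ι (liftMap (qbond L j.k j.Mn) ι p) := fun _ => rfl
  obtain ⟨hc1, hc2⟩ := hasMaj_fibAvg_comp (g := unitTorusGeoS L j.k j.Mn j.Msz) (liftBlk (blkFine L j.k j.Mn) ι)
    (liftBlk (fun b : Tor j.Mn × Fin (d + 1) => b.1) ι) (liftMap (qbond L j.k j.Mn) ι) hq (mul_nonneg hcF0 hr0) hMc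
  obtain ⟨hf1, hf2⟩ := hasMaj_fibAvg_comp (g := unitTorusGeoS L j.k j.Mn j.Msz) (liftBlk (blkFine L j.k j.Mn) ι ∘ liftMap (kingPrV L j.k j.m j.Mn) ι)
    (liftBlk (fun b : Tor j.Mn × Fin (d + 1) => b.1) ι) (liftMap (qbond L j.k j.Mn) ι ∘ liftMap (kingPrV L j.k j.m j.Mn) ι) (fun p => hq _)
    (mul_nonneg hcF0 hr0) hMf
  obtain ⟨hd1', hd2'⟩ := hasMaj_idef_fibAvg_comp (g := unitTorusGeoS L j.k j.Mn j.Msz) (liftBlk (blkFine L j.k j.Mn) ι)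
    (liftBlk (fun b : Tor j.Mn × Fin (d + 1) => b.1) ι) (liftMap (qbond L j.k j.Mn) ι) (liftMap (kingPrV L j.k j.m j.Mn) ι) hq
    (pow_ne_zero _ (pow_ne_zero _ hL0)) (card_fibre_kingPrV_lift L j.k j.m j.Mn ι) (mul_nonneg (mul_nonneg hcF0 hr0) hθ0) hMD'
  exact ⟨hc1, hc2, hf1, hf2, hd1', hd2'⟩

end Species

/-! ## §2 The knit with the linearised species: no species letter displayed -/

section Knit

variable {𝔄 : Type} [NormedRing 𝔄] [NormedAlgebra ℝ 𝔄] [CompleteSpace 𝔄] {ι : Type} [Fintype ι] [DecidableEq ι] (e : 𝔄 ≃L[ℝ] (ι → ℝ)) {L : ℕ} [NeZero L]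
  (a : ℝ)

/-- **NE2⁺, OPERATOR LAYER — `T4EtaRate.NE2PlusOperator` BY NAME FOR THE U = 1 VECTOR PIECE ⊗ 1_𝔤 DRESSED BY THE (3.60)-SHAPED FULL PERTURBATION WITH THE
LINEARISED AVERAGING-PERTURBATION SPECIES** `F₂(A′) = Q∘M_{ad(ηΣ_Γ Ā)}`, `F₂*(A′) = M_{ad(ηΣ_Γ Ā)}∘Q*` (fine: `η′`, `A′`): `d + 1 ≥ 2`, `L ≥ 1`, every `c₃₅ > 0`, every (3.24)
weight `a` — `ne2PlusOperator_vectorPiece_vWordsG` with ALL SIX species letters DISCHARGED by `linF_letters` (`c_F = 2(d+1)(2d+3)κ_e`).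
[cite: Balaban1985BackgroundPropagators, Thm 3.1 p.397 (quantifier template), (3.35)–(3.36) p.396, (3.42) p.397, (3.52) p.400, (3.57)–(3.65) pp.401–403 (shapes, mechanism); King1986, (4.42)–(4.43) p.675, p.664] -/
theorem ne2PlusOperator_vectorPiece_vWordsLin (hd : 1 ≤ d) (hL : 1 ≤ L) (c35 : ℝ) (hc35 : 0 < c35) :
    NE2PlusOperator c35 (v1GVecInstance (d := d) 𝔄 ι L hL)
      (vWGVecFamily4 (d := d) 𝔄 ι e L a hL (linFc ι e L) (linFsc ι e L) (linFf ι e L) (linFsf ι e L)) :=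
  ne2PlusOperator_vectorPiece_vWordsG (d := d) e a hd hL c35 hc35 (linCF_nonneg_le (d := d) (basisConst_nonneg e)).1 (linFc ι e L) (linFsc ι e L)
    (linFf ι e L) (linFsf ι e L) fun j _ _ hα₀ _ hreg => linF_letters (d := d) e hL j hc35 hα₀ hreg

/-- The four-dimensional instance (`d + 1 = 4`). [cite: Balaban1985BackgroundPropagators, Thm 3.1 p.397 (quantifier template)] -/
theorem ne2PlusOperator_vectorPiece_vWordsLin_dim4 (hL : 1 ≤ L) (c35 : ℝ) (hc35 : 0 < c35) :
    NE2PlusOperator c35 (v1GVecInstance (d := 3) 𝔄 ι L hL)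
      (vWGVecFamily4 (d := 3) 𝔄 ι e L a hL (linFc ι e L) (linFsc ι e L) (linFf ι e L) (linFsf ι e L)) :=
  ne2PlusOperator_vectorPiece_vWordsLin (d := 3) e a (by norm_num) hL c35 hc35

/-- **NE2⁰ FOR THE SAME FAMILY** (`T4EtaRate.ne2Zero_of_ne2Plus` at `c₃₅ = 1`; the trivial gauge field is C²-regular). [cite: King1986, Props. 3.8–3.9 (3.71)–(3.75) pp.664–665 (A = 0 model)] -/
theorem ne2ZeroOperator_vectorPiece_vWordsLin (hd : 1 ≤ d) (hL : 1 ≤ L) :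
    NE2ZeroOperator (v1GVecInstance (d := d) 𝔄 ι L hL)
      (vWGVecFamily4 (d := d) 𝔄 ι e L a hL (linFc ι e L) (linFsc ι e L) (linFf ι e L) (linFsf ι e L)) :=
  ne2ZeroOperator_vectorPiece_vWordsG (d := d) e a hd hL (linCF_nonneg_le (d := d) (basisConst_nonneg e)).1 (linFc ι e L) (linFsc ι e L)
    (linFf ι e L) (linFsf ι e L) fun j _ _ hα₀ _ hreg => linF_letters (d := d) e hL j one_pos hα₀ hreg

end Knit

end Summit.QuantumFields.YangMills.BalabanUVNodes.N15.VectorPiece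

end
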